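import Literature.AnabelianGeometry.EtaleTheta.Discharge.Sec5Thm57Constants
import Literature.AnabelianGeometry.EtaleTheta.Discharge.Sec5Thm57Descent

/-!
# [EtTh] §5, Theorem 5.7 at ALL levels: the residual is the torsion of ONE constant of `K` (pp. 330–331 / PDF pp. 104–105)

Mochizuki, *The étale theta function …*, Publ. RIMS **45** (2009)
[cite: MochizukiEtTh2009, Thm 5.7 p.330 (PDF p.104); Rmk 4.3.2 p.319 (PDF p.93); Lem 5.8 p.331 (PDF p.105)].
Seat abc-iut-L2-d4 (node `EtTh:Thm5.7`; THM57-TOWER-PLAN rows T2–T6); PROOF-ONLY, the junction of this seat's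
`Discharge/Sec5Thm57Constants.lean` (per level: the unit discrepancy of a root transport lies in `(O_K^×)^{1/N}`) and
`Discharge/Sec5Thm57Descent.lean` (all levels from the first root along the Remark 4.3.2 transitions).

At the FIRST root (`N = 1`: the right fraction-pair of `Θ̈^{1/l}` itself) `(O_K^×)^{1/1}` is the image of the
constants, so `Sec5Thm57Constants.discrepancy_mem_OKxRootN` says: the level-1 discrepancy `u_1` IS a constant
`c ∈ O_K^× ⊆ K^×` ("the preservation of `Θ̈` up to multiplication by an arbitrary constant function ∈ `O^×(−)`" of
Remark 5.7.1, p.330 (PDF p.104), sharpened to a constant OF `K` by Lemma 5.8).  Hence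
(`ThetaFrobenioidTower.thetaRootPreservedAll_of_constTorsion`) **Theorem 5.7 at every level `N`, in both halves of
its rigidity clause, follows from the single residual statement "that constant `c` is a `2l`-th root of unity"**
(`hc`) — "the 'rigidity up to possible multiplication by a `2l`-th root of unity' asserted in Theorem 5.7 [which] is
substantially stronger" (Rmk. 5.7.1) — together with the structural inputs of the two parent files (`hfac`, `hdesc`,
`hconst`, the Thm. 4.4 (iv)/Prop. 2.4 transport data, the [FrdI] binders, abc-iut-L2-t4's §5 facts by name).  What
proves `hc` in print: Cor. 2.8 (i) applied to the Kummer classes of Prop. 5.2 (iii) through the isomorphisms of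
Prop. 5.5 preserved by `Ψ` (Thm. 5.6), then Prop. 3.2 (iii) (`Sec5Thm57Descent.pow_eq_one_of_kummerTrivial`) — the
anabelian input, gated on the genuine §2/§5 data (W3-L2-01/02).
HONEST FRAMING: kernel-checked implications between typed statements about the §5 data under named hypotheses;
nothing of [EtTh] is asserted unconditionally; typed ≠ discharged; no side taken on anything downstream. -/

namespace Literature.AnabelianGeometry.EtaleTheta

open CategoryTheory
open Literature.AlgebraicGeometry.Frobenioids

universe w v v' u u'

namespace ThetaFrobenioid

variable {C : Type u} [Category.{v} C] {D : Type u'} [Category.{v'} D] {𝔉 : ThetaFrobenioid.{w} C D}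

/-- At the first root (`N = 1`) an element of `(O_K^×)^{1/N}` IS (the image of) a constant of `K`:
`u ∈ (O_K^×)^{1/1} ⇒ u ∈ Im(K^× ↪ O^×(B_1^birat))` (Lemma 5.8 with `N = 1`, p.331 (PDF p.105)).
[cite: MochizukiEtTh2009, Lem 5.8 p.331 (PDF p.105)] -/
theorem exists_const_of_mem_OKxRootN_of_N_eq_one (hN : (𝔉.N : ℕ) = 1) {u : Aut 𝔉.BN} (hu : u ∈ 𝔉.units 𝔉.BN)
    (hO : u ∈ 𝔉.OKxRootN) : ∃ c : 𝔉.Kˣ, 𝔉.unitsToBirat 𝔉.BN ⟨u, hu⟩ = 𝔉.constEmb c := by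
  obtain ⟨hu', c, hc⟩ := (mem_OKxRootN_iff u).mp hO
  refine ⟨c, ?_⟩
  rw [hN, pow_one] at hc
  exact hc.symm

end ThetaFrobenioid

namespace ThetaFrobenioidTower

variable {C : Type u} [Category.{v} C] {D : Type u'} [Category.{v'} D] (𝔗 : ThetaFrobenioidTower.{w} C D)
  (Ψ : C ≌ C)

/-- **The level-1 rigidity clause from the torsion of the level-1 constant.**  For a root transport at the FIRST
root (`hT₁`, `hT₁'`, `u_1 := D_c¹⁻¹·D_p¹ ∈ O^×(B_1)`) with its Thm. 4.4 (iv)/Prop. 2.4 data (`θ₁, hstrv₁, hYdd₁`),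
the level-1 §5 facts (`SgpCapSpec`, `SgpCupSpec`, Prop. 4.3 (iii), Lemma 5.8 by name), `Ψ^Aut(O^×(B_1)) = O^×(B_1)`
and the factorisation `hfac₁`, the unit `u_1` is a constant `c ∈ K^×` (`Sec5Thm57Constants.discrepancy_mem_OKxRootN`
at `N = 1`); if every such constant is a `2l`-th root of unity (`hc` — Thm. 5.7's "up to possible multiplication by a
`2l`-th root of unity" read at the first root), then `u_1 = ζ ∈ μ_{2l}(K)`, i.e. the hypothesis `hζ₁` of
`thetaRootPreservedAll_of_levelOne`.  [cite: MochizukiEtTh2009, Thm 5.7 p.330 (PDF p.104); Lem 5.8 p.331 (PDF p.105)] -/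
theorem hζ₁_of_constTorsion (hepi : ∀ ⦃X Y : C⦄ (f : X ⟶ Y), Epi f) (hcap : (𝔗.atLevel 1).SgpCapSpec)
    (hcup : (𝔗.atLevel 1).SgpCupSpec) (hdiff : (𝔗.atLevel 1).BiKummerDifferenceMem)
    (h58 : (𝔗.atLevel 1).ConstantsActByCyclotome)
    (hfac : ∀ y ∈ (𝔗.atLevel 1).imPiY, ∃ h ∈ (𝔗.atLevel 1).HB, ∀ u ∈ (𝔗.atLevel 1).units (𝔗.BN 1),
      𝔗.sgpCap 1 y * u * (𝔗.sgpCap 1 y)⁻¹ = 𝔗.sgpCap 1 h * u * (𝔗.sgpCap 1 h)⁻¹)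
    {α₁ : Ψ.functor.obj (𝔗.AN 1) ≅ 𝔗.AN 1} {β₁ : Ψ.functor.obj (𝔗.BN 1) ≅ 𝔗.BN 1} {e₁ : 𝔗.AN 1 ≅ 𝔗.AN 1}
    {Dc₁ Dp₁ : Aut (𝔗.BN 1)} (θ₁ : Aut (𝔗.pre.base.obj (𝔗.BN 1)) ≃* Aut (𝔗.pre.base.obj (𝔗.BN 1)))
    (hU : ((𝔗.atLevel 1).units (𝔗.BN 1)).map ((𝔗.atLevel 1).psiAut Ψ β₁) = (𝔗.atLevel 1).units (𝔗.BN 1))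
    (hT₁ : α₁.inv ≫ Ψ.functor.map (𝔗.sCap 1) ≫ β₁.hom = e₁.hom ≫ 𝔗.sCap 1 ≫ Dc₁.hom)
    (hT₁' : α₁.inv ≫ Ψ.functor.map (𝔗.sCup 1) ≫ β₁.hom = e₁.hom ≫ 𝔗.sCup 1 ≫ Dp₁.hom)
    (hstrv : (𝔗.atLevel 1).StrvTransport Ψ α₁ e₁ θ₁)
    (hYdd : (𝔗.atLevel 1).HB.map θ₁.toMonoidHom = (𝔗.atLevel 1).HB)
    (hu₁ : Dc₁⁻¹ * Dp₁ ∈ (𝔗.atLevel 1).units (𝔗.BN 1))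
    (hc : ∀ c : 𝔗.Kˣ, (𝔗.atLevel 1).unitsToBirat (𝔗.BN 1) ⟨Dc₁⁻¹ * Dp₁, hu₁⟩ = 𝔗.constEmb 1 c →
      c ^ (2 * 𝔗.l) = 1) :
    ∃ ζ : 𝔗.Kˣ, ζ ^ (2 * 𝔗.l) = 1 ∧ (𝔗.atLevel 1).unitsToBirat (𝔗.BN 1) ⟨Dc₁⁻¹ * Dp₁, hu₁⟩ = 𝔗.constEmb 1 ζ := by
  haveI := hepi (𝔗.sCap 1)
  haveI := hepi (𝔗.sCup 1)
  have hO := ThetaFrobenioid.discrepancy_mem_OKxRootN (𝔉 := 𝔗.atLevel 1) Ψ α₁ β₁ e₁ Dc₁ Dp₁ θ₁ hcap hcup hdiff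
    h58 hfac hU hT₁ hT₁' hstrv hYdd hu₁
  obtain ⟨c, hc'⟩ :=
    ThetaFrobenioid.exists_const_of_mem_OKxRootN_of_N_eq_one (𝔉 := 𝔗.atLevel 1) PNat.one_coe hu₁ hO
  exact ⟨c, hc c hc', hc'⟩

/-- **[EtTh] Theorem 5.7 (root level) at ALL levels, modulo the torsion of the level-1 constant** —
`ThetaRootPreservedAll Ψ` from: the [FrdI] inputs over `𝔗.pre`; Prop. 5.3 (vi) at every `A_N` (`hdiv`); the
compatible descent to level `1` (`hdesc`) and the unit law along `β_{1,N}` (`hconst`) of `Sec5Thm57Descent`; AT LEVEL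
1 ONLY: abc-iut-L2-t4's §5 facts (`SgpCapSpec`, `SgpCupSpec`, Prop. 4.3 (iii), Lemma 5.8 by name), the factorisation
`hfac₁`, `Ψ^Aut(O^×(B_1)) = O^×(B_1)` (`hU₁`), the Thm. 4.4 (iv)/Prop. 2.4 transport data for every level-1 root
transport (`hθ₁`); and the ONE residual `hc`: the level-1 discrepancy constant `c ∈ K^×` is a `2l`-th root of unity
(Cor. 2.8 (i) via Prop. 5.2 (iii)/Prop. 5.5/Thm. 5.6 and Prop. 3.2 (iii) — the anabelian input).
[cite: MochizukiEtTh2009, Thm 5.7 p.329–330 (PDF pp.103–104); Rmk 4.3.2 p.318–319 (PDF pp.92–93); Rmk 5.7.1 p.330 (PDF p.104)] -/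
theorem thetaRootPreservedAll_of_constTorsion (hepi : ∀ ⦃X Y : C⦄ (f : X ⟶ Y), Epi f)
    (hiso : 𝔗.pre.IsOfIsotropicType)
    (hiiid : ∀ ⦃A B B' : C⦄ (φ : A ⟶ B) (φ' : A ⟶ B'), 𝔗.pre.IsCoAngularPreStep φ →
      𝔗.pre.IsCoAngularPreStep φ' → 𝔗.pre.div φ ∣ 𝔗.pre.div φ' →
        ∃ f : B ⟶ B', 𝔗.pre.IsCoAngularPreStep f ∧ φ ≫ f = φ')
    (hpre : PreFrobenioidData.PreservesMor Ψ.functor 𝔗.pre.IsPreStep 𝔗.pre.IsPreStep)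
    (hbe : ∀ ⦃A B : C⦄ (φ ψ : A ⟶ B), 𝔗.pre.BaseEquivalent φ ψ →
      𝔗.pre.BaseEquivalent (Ψ.functor.map φ) (Ψ.functor.map ψ))
    (hdiv : ∀ (N : ℕ+) (α : Ψ.functor.obj (𝔗.AN N) ≅ 𝔗.AN N) (β : Ψ.functor.obj (𝔗.BN N) ≅ 𝔗.BN N),
      ∃ e : 𝔗.AN N ≅ 𝔗.AN N,
        𝔗.pre.div (α.inv ≫ Ψ.functor.map (𝔗.sCap N) ≫ β.hom) = 𝔗.pre.div (e.hom ≫ 𝔗.sCap N) ∧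
        𝔗.pre.div (α.inv ≫ Ψ.functor.map (𝔗.sCup N) ≫ β.hom) = 𝔗.pre.div (e.hom ≫ 𝔗.sCup N))
    (hdesc : ∀ (N : ℕ+) (α : Ψ.functor.obj (𝔗.AN N) ≅ 𝔗.AN N) (β : Ψ.functor.obj (𝔗.BN N) ≅ 𝔗.BN N)
      (e : 𝔗.AN N ≅ 𝔗.AN N) (Dc Dp : Aut (𝔗.BN N)),
      α.inv ≫ Ψ.functor.map (𝔗.sCap N) ≫ β.hom = e.hom ≫ 𝔗.sCap N ≫ Dc.hom →
      α.inv ≫ Ψ.functor.map (𝔗.sCup N) ≫ β.hom = e.hom ≫ 𝔗.sCup N ≫ Dp.hom →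
      ∃ (α₁ : Ψ.functor.obj (𝔗.AN 1) ≅ 𝔗.AN 1) (β₁ : Ψ.functor.obj (𝔗.BN 1) ≅ 𝔗.BN 1) (e₁ : 𝔗.AN 1 ≅ 𝔗.AN 1),
        α.inv ≫ Ψ.functor.map (𝔗.α (one_dvd_level N)) ≫ α₁.hom = 𝔗.α (one_dvd_level N) ∧
        β.inv ≫ Ψ.functor.map (𝔗.β (one_dvd_level N)) ≫ β₁.hom = 𝔗.β (one_dvd_level N) ∧
        𝔗.α (one_dvd_level N) ≫ e₁.hom = e.hom ≫ 𝔗.α (one_dvd_level N) ∧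
        𝔗.pre.div (α₁.inv ≫ Ψ.functor.map (𝔗.sCap 1) ≫ β₁.hom) = 𝔗.pre.div (e₁.hom ≫ 𝔗.sCap 1) ∧
        𝔗.pre.div (α₁.inv ≫ Ψ.functor.map (𝔗.sCup 1) ≫ β₁.hom) = 𝔗.pre.div (e₁.hom ≫ 𝔗.sCup 1))
    (hconst : ∀ (N : ℕ+) (u : Aut (𝔗.BN N)) (hu : u ∈ (𝔗.atLevel N).units (𝔗.BN N)) (u₁ : Aut (𝔗.BN 1))
      (hu₁ : u₁ ∈ (𝔗.atLevel 1).units (𝔗.BN 1)) (c : 𝔗.Kˣ),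
      u.hom ≫ 𝔗.β (one_dvd_level N) = 𝔗.β (one_dvd_level N) ≫ u₁.hom →
      (𝔗.atLevel 1).unitsToBirat (𝔗.BN 1) ⟨u₁, hu₁⟩ = 𝔗.constEmb 1 c →
        (𝔗.atLevel N).unitsToBirat (𝔗.BN N) ⟨u, hu⟩ ^ (N : ℕ) = 𝔗.constEmb N c)
    (hcap₁ : (𝔗.atLevel 1).SgpCapSpec) (hcup₁ : (𝔗.atLevel 1).SgpCupSpec)
    (hdiff₁ : (𝔗.atLevel 1).BiKummerDifferenceMem) (h58₁ : (𝔗.atLevel 1).ConstantsActByCyclotome)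
    (hfac₁ : ∀ y ∈ (𝔗.atLevel 1).imPiY, ∃ h ∈ (𝔗.atLevel 1).HB, ∀ u ∈ (𝔗.atLevel 1).units (𝔗.BN 1),
      𝔗.sgpCap 1 y * u * (𝔗.sgpCap 1 y)⁻¹ = 𝔗.sgpCap 1 h * u * (𝔗.sgpCap 1 h)⁻¹)
    (hU₁ : ∀ β₁ : Ψ.functor.obj (𝔗.BN 1) ≅ 𝔗.BN 1,
      ((𝔗.atLevel 1).units (𝔗.BN 1)).map ((𝔗.atLevel 1).psiAut Ψ β₁) = (𝔗.atLevel 1).units (𝔗.BN 1))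
    (hθ₁ : ∀ (α₁ : Ψ.functor.obj (𝔗.AN 1) ≅ 𝔗.AN 1) (β₁ : Ψ.functor.obj (𝔗.BN 1) ≅ 𝔗.BN 1)
      (e₁ : 𝔗.AN 1 ≅ 𝔗.AN 1) (Dc₁ Dp₁ : Aut (𝔗.BN 1)),
      α₁.inv ≫ Ψ.functor.map (𝔗.sCap 1) ≫ β₁.hom = e₁.hom ≫ 𝔗.sCap 1 ≫ Dc₁.hom →
      α₁.inv ≫ Ψ.functor.map (𝔗.sCup 1) ≫ β₁.hom = e₁.hom ≫ 𝔗.sCup 1 ≫ Dp₁.hom →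
      ∃ θ₁ : Aut (𝔗.pre.base.obj (𝔗.BN 1)) ≃* Aut (𝔗.pre.base.obj (𝔗.BN 1)),
        (𝔗.atLevel 1).StrvTransport Ψ α₁ e₁ θ₁ ∧ (𝔗.atLevel 1).HB.map θ₁.toMonoidHom = (𝔗.atLevel 1).HB)
    (hc : ∀ (α₁ : Ψ.functor.obj (𝔗.AN 1) ≅ 𝔗.AN 1) (β₁ : Ψ.functor.obj (𝔗.BN 1) ≅ 𝔗.BN 1)
      (e₁ : 𝔗.AN 1 ≅ 𝔗.AN 1) (Dc₁ Dp₁ : Aut (𝔗.BN 1)),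
      α₁.inv ≫ Ψ.functor.map (𝔗.sCap 1) ≫ β₁.hom = e₁.hom ≫ 𝔗.sCap 1 ≫ Dc₁.hom →
      α₁.inv ≫ Ψ.functor.map (𝔗.sCup 1) ≫ β₁.hom = e₁.hom ≫ 𝔗.sCup 1 ≫ Dp₁.hom →
      ∀ (hu₁ : Dc₁⁻¹ * Dp₁ ∈ (𝔗.atLevel 1).units (𝔗.BN 1)) (c : 𝔗.Kˣ),
        (𝔗.atLevel 1).unitsToBirat (𝔗.BN 1) ⟨Dc₁⁻¹ * Dp₁, hu₁⟩ = 𝔗.constEmb 1 c → c ^ (2 * 𝔗.l) = 1) :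
    𝔗.ThetaRootPreservedAll Ψ :=
  𝔗.thetaRootPreservedAll_of_levelOne Ψ hepi hiso hiiid hpre hbe hdiv hdesc hconst
    fun α₁ β₁ e₁ Dc₁ Dp₁ hT₁ hT₁' hu₁ => by
      obtain ⟨θ₁, hstrv, hYdd⟩ := hθ₁ α₁ β₁ e₁ Dc₁ Dp₁ hT₁ hT₁'
      exact 𝔗.hζ₁_of_constTorsion Ψ hepi hcap₁ hcup₁ hdiff₁ h58₁ hfac₁ θ₁ (hU₁ β₁) hT₁ hT₁' hstrv hYdd hu₁
        (hc α₁ β₁ e₁ Dc₁ Dp₁ hT₁ hT₁' hu₁)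

end ThetaFrobenioidTower

end Literature.AnabelianGeometry.EtaleTheta
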